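import Summits.KontsevichZagierPeriods.KontsevichZagierPeriods.Theorems.LinRedNormalFormArrangementNormalFormStubRebaseSimplePosOneFibreParNonpinch
import Summits.KontsevichZagierPeriods.KontsevichZagierPeriods.Theorems.LinRedNormalFormArrangementNormalFormStubRebaseSimplePosOneFibreSwapForms

/-!
# Stub `stub_rebaseSimplePosOneZero`, residual hypothesis `Hpar` (crux `ArrangementNormalForm`,
line `janus-bands`, v10) — sub-part `ParLevel`: parallel bands over PINCHING product cells

**Level splits of a parallel band over a product cell.** The data of `Hpar` (one fibre `t`,
letter `0`, affine bounds `u < v` PARALLEL in `y`: `u_y = v_y = s₀`, so that the width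
`w = v − u` is `y`-free) over a PRODUCT cell `{M₀-rows in x'} × (ylo(x'), yhi(x'))` (the
forward direction of `hsec`). If the `y`-range is SHORT against the width,
`|s₀| (yhi − ylo) ≤ w` on the base cell (`hfit`), then the `y`-free level
`κ(x') = u(x', yhi(x'))` (`s₀ ≥ 0`; `u(x', ylo(x'))` if `s₀ < 0`) lies between `u` and `v` on
the whole cell, and ONE fibre cut at `κ` (rule 1a) puts both pieces in the product case
(`RebasePos.good_levelSplit`): `RebasePos.good_parLevel_one`. If only
`|s₀| (yhi − ylo) ≤ (N + 1) w` (`RebasePos.good_parLevel`), cut the cell into `N + 1`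
horizontal strips `ylo + k (yhi − ylo)/(N+1) < y < ylo + (k+1) (yhi − ylo)/(N+1)` (rule 1a,
`RebasePos.cutBase`, induction on `N`), each of which is short. This is exactly the regime of
the PINCHING `y`-ranges left open by `rebaseSimplePos_par_nonpinch`: where `yhi − ylo → 0` at
an end of the `x'`-cell at least as fast as the width `w` (in particular at the corners where
both vanish), finitely many strips suffice; NO convergence estimate is needed (all pieces are
restrictions of the datum). Registered as `rebaseSimplePos_par_level`, target
`closure (GGset B 2 1)`.

References: M. Kontsevich, D. Zagier, *Periods* (2001), §1.2, rule (1a).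
-/

noncomputable section

open Set MeasureTheory MvPolynomial
open Literature.NumberTheory.Transcendental Literature.ModelTheory.ExponentialFields

namespace Summit.KontsevichZagierPeriods.ArrangementNormalForm.JanusBands

namespace RebasePos

open SeparatePos

section Level

variable {B m m' m₀ : ℕ} (L : Fin m → (Fin B → ℚ) × ℚ) (e : Fin m → ℕ) (ℓ₁ ℓ₂ : (Fin B → ℚ) × ℚ)
  (n₁ n₂ : ℕ)

/-- The full-base form with `x'`-part `d` and `y`-coefficient `c` (written
`((Fin.snoc d.1 c), d.2)`) evaluates to `c y + d(x')`. -/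
theorem affF_snocF (d : (Fin B → ℚ) × ℚ) (c : ℚ) (z : Fin (B + 1 + 1) → ℝ) :
    affF B 1 (((Fin.snoc d.1 c : Fin (B + 1) → ℚ), d.2) : (Fin (B + 1) → ℚ) × ℚ) z =
      (c : ℝ) * z (Fin.castAdd 1 (Fin.last B)) + affB B 1 d z := by
  simp only [affF, affB, Fin.sum_univ_castSucc, Fin.snoc_castSucc, Fin.snoc_last]
  ring

/-- The form `((Fin.snoc d.1 c), d.2)` is non-zero as soon as `c ≠ 0`. -/
theorem snocF_ne_zero (d : (Fin B → ℚ) × ℚ) {c : ℚ} (hc : c ≠ 0) :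
    (((Fin.snoc d.1 c : Fin (B + 1) → ℚ), d.2) : (Fin (B + 1) → ℚ) × ℚ) ≠ 0 :=
  ne_zero_of_last (by simpa using hc)

/-- The width of a parallel band is `y`-free: `v − u = v|ₓ' − u|ₓ'`. -/
theorem width_eq (u v : (Fin (B + 1) → ℚ) × ℚ) (hpar : u.1 (Fin.last B) = v.1 (Fin.last B))
    (z : Fin (B + 1 + 1) → ℝ) :
    affF B 1 v z - affF B 1 u z = affB B 1 (restr B v) z - affB B 1 (restr B u) z := by
  rw [affF_split u z, affF_split v z, hpar]
  ring

/-- **A short parallel band over a product cell: one level split.** See the module docstring. -/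
theorem good_parLevel_one (s : KZ.IntegralRep (B + 1 + 1)) (M : Fin m' → (Fin (B + 1) → ℚ) × ℚ)
    (M₀ : Fin m₀ → (Fin B → ℚ) × ℚ) (ylo yhi : (Fin B → ℚ) × ℚ) (p : MvPolynomial (Fin B) ℚ)
    (u v : (Fin (B + 1) → ℚ) × ℚ) (h12 : n₁ = 0 ∨ n₂ = 0) (hbd : Bornology.IsBounded s.domain)
    (hdom : s.domain = gDom B 1 m' M (fun _ => Sum.inr u) (fun _ => Sum.inr v))
    (hint : EqOn s.integrand (glit B 1 p L e ℓ₁ ℓ₂ n₁ n₂ (fun _ => some 0)) s.domain)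
    (hpar : u.1 (Fin.last B) = v.1 (Fin.last B))
    (hsec : ∀ z : Fin (B + 1 + 1) → ℝ, (∀ j, 0 < affF B 1 (M j) z) → ((∀ j, 0 < affB B 1 (M₀ j) z) ∧
      affB B 1 ylo z < z (Fin.castAdd 1 (Fin.last B)) ∧ z (Fin.castAdd 1 (Fin.last B)) < affB B 1 yhi z))
    (hfit : ∀ z : Fin (B + 1 + 1) → ℝ, (∀ j, 0 < affF B 1 (M j) z) →
      |(u.1 (Fin.last B) : ℝ)| * (affB B 1 yhi z - affB B 1 ylo z) ≤ affF B 1 v z - affF B 1 u z) :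
    ∃ c ∈ AddSubgroup.closure (GGset B 2 1), KZ.of s - c ∈ KZ.relations := by
  set s₀ : ℚ := u.1 (Fin.last B) with hs₀
  -- the level: `u(x', yhi)` if `s₀ ≥ 0`, `u(x', ylo)` if `s₀ < 0`
  set θ : (Fin B → ℚ) × ℚ := if 0 ≤ s₀ then yhi else ylo with hθ
  set κ : (Fin (B + 1) → ℚ) × ℚ :=
    (((Fin.snoc (restr B u + s₀ • θ).1 0 : Fin (B + 1) → ℚ), (restr B u + s₀ • θ).2)) with hκ
  refine good_levelSplit (fun _ => some 0) (fun _ => u) (fun _ => v) s M L e p ℓ₁ ℓ₂ _ _ h12 hbd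
    hdom hint (fun _ => rfl) (fun _ => rfl) 0 κ (fun i c hi _ => absurd (Subsingleton.elim i 0) hi)
    (fun c hc => ?_) fun z hz => ?_
  · simp only [Option.some.injEq] at hc
    rw [← hc, hκ]
    simp
  · obtain ⟨-, hlo, hhi⟩ := hsec z hz
    have hf := hfit z hz
    have hu' := affF_split u z
    have hv' := affF_split v z
    rw [← hpar] at hv'
    have hκz : affF B 1 κ z = affB B 1 (restr B u) z + (s₀ : ℝ) * affB B 1 θ z := by
      rw [hκ, affF_snocF, affB_addYT, affB_smul']
      push_cast
      ring
    rw [hκz]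
    rw [hu', hv'] at hf ⊢
    by_cases hsgn : 0 ≤ s₀
    · have hθ' : θ = yhi := if_pos hsgn
      rw [hθ']
      have hs : (0 : ℝ) ≤ (s₀ : ℝ) := by exact_mod_cast hsgn
      rw [abs_of_nonneg hs] at hf
      have e1 := mul_le_mul_of_nonneg_left hhi.le hs
      have e2 := mul_le_mul_of_nonneg_left hlo.le hs
      constructor <;> nlinarith
    · push Not at hsgn
      have hθ' : θ = ylo := if_neg (not_le.2 hsgn)
      rw [hθ']
      have hs : (s₀ : ℝ) < 0 := by exact_mod_cast hsgn
      rw [abs_of_neg hs] at hf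
      have e1 := mul_le_mul_of_nonpos_left hhi.le hs.le
      have e2 := mul_le_mul_of_nonpos_left hlo.le hs.le
      constructor <;> nlinarith

/-- **A parallel band over a product cell whose `y`-range is at most `N + 1` widths: `N + 1`
horizontal strips, each a level split.** See the module docstring. -/
theorem good_parLevel (M₀ : Fin m₀ → (Fin B → ℚ) × ℚ) (yhi : (Fin B → ℚ) × ℚ)
    (p : MvPolynomial (Fin B) ℚ) (u v : (Fin (B + 1) → ℚ) × ℚ) (h12 : n₁ = 0 ∨ n₂ = 0)
    (hpar : u.1 (Fin.last B) = v.1 (Fin.last B)) (N : ℕ) :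
    ∀ {m' : ℕ} (s : KZ.IntegralRep (B + 1 + 1)) (M : Fin m' → (Fin (B + 1) → ℚ) × ℚ)
    (ylo : (Fin B → ℚ) × ℚ), Bornology.IsBounded s.domain →
    s.domain = gDom B 1 m' M (fun _ => Sum.inr u) (fun _ => Sum.inr v) →
    EqOn s.integrand (glit B 1 p L e ℓ₁ ℓ₂ n₁ n₂ (fun _ => some 0)) s.domain →
    (∀ z : Fin (B + 1 + 1) → ℝ, (∀ j, 0 < affF B 1 (M j) z) → ((∀ j, 0 < affB B 1 (M₀ j) z) ∧
      affB B 1 ylo z < z (Fin.castAdd 1 (Fin.last B)) ∧ z (Fin.castAdd 1 (Fin.last B)) < affB B 1 yhi z)) →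
    (∀ z : Fin (B + 1 + 1) → ℝ, (∀ j, 0 < affF B 1 (M j) z) →
      |(u.1 (Fin.last B) : ℝ)| * (affB B 1 yhi z - affB B 1 ylo z) ≤
        ((N : ℝ) + 1) * (affF B 1 v z - affF B 1 u z)) →
    ∃ c ∈ AddSubgroup.closure (GGset B 2 1), KZ.of s - c ∈ KZ.relations := by
  induction N with
  | zero =>
    intro m' s M ylo hbd hdom hint hsec hfit
    exact good_parLevel_one L e ℓ₁ ℓ₂ n₁ n₂ s M M₀ ylo yhi p u v h12 hbd hdom hint hpar hsec
      fun z hz => by simpa using hfit z hz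
  | succ N ih =>
    intro m' s M ylo hbd hdom hint hsec hfit
    -- the first strip level `θ = ylo + (yhi − ylo)/(N + 2)`
    set q : ℚ := 1 / ((N : ℚ) + 2) with hq
    set θ : (Fin B → ℚ) × ℚ := ylo + q • (yhi - ylo) with hθ
    have hq0 : (0 : ℝ) < (N : ℝ) + 2 := by positivity
    have hqR : (q : ℝ) = 1 / ((N : ℝ) + 2) := by rw [hq]; push_cast; ring
    have hθz : ∀ z : Fin (B + 1 + 1) → ℝ, affB B 1 θ z =
        affB B 1 ylo z + (q : ℝ) * (affB B 1 yhi z - affB B 1 ylo z) := fun z => by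
      rw [hθ, affB_addYT, affB_smul', affB_sub]
    obtain ⟨s₁, s₂, hm₁, hm₂, hi₁, hi₂, hd₁, hd₂, hrel⟩ :=
      cutBase s M _ _ hdom (((Fin.snoc (-θ).1 1 : Fin (B + 1) → ℚ), (-θ).2)) (snocF_ne_zero _ one_ne_zero)
    have hsub₁ : s₁.domain ⊆ s.domain := fun z hz => ((hm₁ z).1 hz).1
    have hsub₂ : s₂.domain ⊆ s.domain := fun z hz => ((hm₂ z).1 hz).1
    have hcut : ∀ z : Fin (B + 1 + 1) → ℝ,
        affF B 1 (((Fin.snoc (-θ).1 1 : Fin (B + 1) → ℚ), (-θ).2) : (Fin (B + 1) → ℚ) × ℚ) z =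
        z (Fin.castAdd 1 (Fin.last B)) - affB B 1 θ z := fun z => by
      rw [affF_snocF, affB_neg']
      push_cast
      ring
    refine good_of_split hrel ?_ ?_
    · -- the upper part `θ < y < yhi`: `N + 1` strips by induction
      refine ih s₁ (Fin.snoc M (((Fin.snoc (-θ).1 1 : Fin (B + 1) → ℚ), (-θ).2))) θ (hbd.subset hsub₁) hd₁
        (by rw [hi₁]; exact hint.mono hsub₁) (fun z hz => ?_) (fun z hz => ?_)
      · obtain ⟨hz', hθ'⟩ := rows_snoc hz
        rw [hcut] at hθ'
        obtain ⟨h0, -, hhi⟩ := hsec z hz'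
        exact ⟨h0, by linarith, hhi⟩
      · obtain ⟨hz', -⟩ := rows_snoc hz
        have hf := hfit z hz'
        obtain ⟨-, hlo, hhi⟩ := hsec z hz'
        rw [hθz]
        have hw : 0 ≤ affF B 1 v z - affF B 1 u z := by
          have h0 : 0 ≤ |(u.1 (Fin.last B) : ℝ)| * (affB B 1 yhi z - affB B 1 ylo z) :=
            mul_nonneg (abs_nonneg _) (by linarith)
          push_cast at hf
          nlinarith
        -- `|s₀| (yhi − θ) = |s₀| h (N+1)/(N+2) ≤ (N+1) w`
        have key : |(u.1 (Fin.last B) : ℝ)| * (affB B 1 yhi z - (affB B 1 ylo z +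
            (q : ℝ) * (affB B 1 yhi z - affB B 1 ylo z))) =
            (((N : ℝ) + 1) / ((N : ℝ) + 2)) * (|(u.1 (Fin.last B) : ℝ)| *
              (affB B 1 yhi z - affB B 1 ylo z)) := by
          rw [hqR]
          field_simp
          ring
        rw [key]
        push_cast at hf ⊢
        rw [div_mul_eq_mul_div, div_le_iff₀ hq0]
        nlinarith
    · -- the lowest strip `ylo < y < θ`: one level split
      refine good_parLevel_one L e ℓ₁ ℓ₂ n₁ n₂ s₂
        (Fin.snoc M (-(((Fin.snoc (-θ).1 1 : Fin (B + 1) → ℚ), (-θ).2)))) M₀ ylo θ p u v h12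
        (hbd.subset hsub₂) hd₂ (by rw [hi₂]; exact hint.mono hsub₂) hpar (fun z hz => ?_)
        (fun z hz => ?_)
      · obtain ⟨hz', hθ'⟩ := rows_snoc hz
        rw [affF_neg', hcut] at hθ'
        obtain ⟨h0, hlo, -⟩ := hsec z hz'
        exact ⟨h0, hlo, by linarith⟩
      · obtain ⟨hz', -⟩ := rows_snoc hz
        have hf := hfit z hz'
        obtain ⟨-, hlo, hhi⟩ := hsec z hz'
        rw [hθz]
        have key : |(u.1 (Fin.last B) : ℝ)| * (affB B 1 ylo z + (q : ℝ) * (affB B 1 yhi z -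
            affB B 1 ylo z) - affB B 1 ylo z) =
            (1 / ((N : ℝ) + 2)) * (|(u.1 (Fin.last B) : ℝ)| * (affB B 1 yhi z - affB B 1 ylo z)) := by
          rw [hqR]
          ring
        rw [key]
        push_cast at hf ⊢
        rw [div_mul_eq_mul_div, div_le_iff₀ hq0]
        nlinarith

end Level

end RebasePos

/-- **Registered part of `stub_rebaseSimplePosOneZero`, residual hypothesis `Hpar` (line
`janus-bands`, v10): parallel bands over a product cell whose `y`-range is at most `N + 1`
widths.** The data of `Hpar` (one lettered fibre over a base of dimension `B + 1`, letter `0`,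
affine bounds `u`, `v` parallel in `y` with common slope `s₀`, any exponents `n₁ n₂` with
`n₁ = 0 ∨ n₂ = 0`), over a base cell contained in a PRODUCT `{x'-rows M₀} × (ylo(x'), yhi(x'))`
(`hsec`, forward direction only) on which `|s₀| (yhi − ylo) ≤ (N + 1)(v − u)` (`hfit`): THEN
`[s]` is congruent modulo `KZ.relations` to the subgroup generated by the literal class
`GG B 2 1` (`RebasePos.good_parLevel`: `N + 1` horizontal strips, rule 1a, and on each strip
one fibre cut at the `y`-free level `u(x', y_top(x'))` resp. `u(x', y_bot(x'))` followed by
two per-fibre affine pull-backs, `RebasePos.good_levelSplit`). This closes the PINCHING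
`y`-ranges of `Hpar` wherever the `y`-range is dominated by the width (e.g. at the corners
where both vanish); no convergence estimate is involved. -/
theorem rebaseSimplePos_par_level (B m m' m₀ n₁ n₂ N : ℕ) (s : KZ.IntegralRep (B + 1 + 1)) (M : Fin m' → (Fin (B + 1) → ℚ) × ℚ) (M₀ : Fin m₀ → (Fin B → ℚ) × ℚ) (ylo yhi : (Fin B → ℚ) × ℚ) (L : Fin m → (Fin B → ℚ) × ℚ) (e : Fin m → ℕ) (p : MvPolynomial (Fin B) ℚ) (ℓ₁ ℓ₂ : (Fin B → ℚ) × ℚ) (u v : (Fin (B + 1) → ℚ) × ℚ) (h12 : n₁ = 0 ∨ n₂ = 0) (hbd : Bornology.IsBounded s.domain) (hdom : s.domain = SeparatePos.gDom B 1 m' M (fun _ => Sum.inr u) (fun _ => Sum.inr v)) (hint : Set.EqOn s.integrand (RebasePos.glit B 1 p L e ℓ₁ ℓ₂ n₁ n₂ (fun _ => some 0)) s.domain) (hpar : u.1 (Fin.last B) = v.1 (Fin.last B)) (hsec : ∀ z : Fin (B + 1 + 1) → ℝ, (∀ j, 0 < SeparatePos.affF B 1 (M j) z) → ((∀ j, 0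 < SeparatePos.affB B 1 (M₀ j) z) ∧ SeparatePos.affB B 1 ylo z < z (Fin.castAdd 1 (Fin.last B)) ∧ z (Fin.castAdd 1 (Fin.last B)) < SeparatePos.affB B 1 yhi z)) (hfit : ∀ z : Fin (B + 1 + 1) → ℝ, (∀ j, 0 < SeparatePos.affF B 1 (M j) z) → |(u.1 (Fin.last B) : ℝ)| * (SeparatePos.affB B 1 yhi z - SeparatePos.affB B 1 ylo z) ≤ ((N : ℝ) + 1) * (SeparatePos.affF B 1 v z - SeparatePos.affF B 1 u z)) : ∃ c ∈ AddSubgroup.closure (SeparatePos.GGset B 2 1), KZ.of s - c ∈ KZ.relations :=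
  RebasePos.good_parLevel L e ℓ₁ ℓ₂ n₁ n₂ M₀ yhi p u v h12 hpar N s M ylo hbd hdom hint hsec hfit

end Summit.KontsevichZagierPeriods.ArrangementNormalForm.JanusBands
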